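import Summits.CriticalPhenomena.PercolationContinuityZ3.Theorems.PercAnnulusCrossingIICTwoShapes
import HarnessLib

/-!
# Visits of Kesten's IIC to two far shapes are positively correlated by the MST gain `π(‖x₂−x₁‖)/π(‖x₂‖)` (lane RSW3, p1 gen 26)

builds on p205010 (kernel theorem, internal audit signed; external expert review pending) — NOT used in this file (only `p_c(ℤ^d) > 0`;
hypotheses (A2)□ and `CU⁺_l`).

RSW3 lane (LANE 3 `prim-rsw3`), seat `prim-rsw3-p1` (gen 26).  Helper file (`--supports stmt-CriticalPhenomena-4575`); no definitions,
no sorries.  Memo `run/shared/lean/prim/rsw3/P1-QM.md` §39.7.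

`…IICTwoShapes` (two-sided `π(ρ)²ν(hit T₁ ∩ hit T₂) ≍ π(‖x₁‖)P(L(S₁,ρ))·π(r)P(L(S₂,ρ))`) divided by `…IICCapacity` (`ν(hit T_i) ≍
π(‖x_i‖)P(L(S_i,ρ))/π(ρ)`): the capacities cancel and
**`c·π((l+1)(‖x₂−x₁‖+m+1))·ν(hit T₁)·ν(hit T₂) ≤ π(‖x₂‖)·ν(hit T₁ ∩ hit T₂)`** and **`π(‖x₂‖)·ν(hit T₁ ∩ hit T₂) ≤ C·π(n₂)·ν(hit T₁)·ν(hit T₂)`**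
(`n₂ ≤ ‖x₂ − x₁‖ − m` the scale of the upper step): VISITS TO TWO FAR SHAPES ARE POSITIVELY CORRELATED, BY EXACTLY THE MST GAIN
`π(‖x₂ − x₁‖)/π(‖x₂‖) ≳ 1` — whatever the shapes (gen 25's `…IICVisitsPairCorrelation` for balls).
References: H. Kesten, PTRF 73 (1986) Thm. (8); D. Basu, A. Sapozhnikov, ECP 22 (2017) Thm. 1.1.
-/

noncomputable section

namespace Summit.CriticalPhenomena.PercolationContinuityZ3.Theorems.Crossing

open MeasureTheory Filter Topology Literature.Probability.Percolation Literature.Probability.LatticeModels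
open Literature.Probability.Percolation.DCT16
open Summit.CriticalPhenomena.PercolationContinuityZ3.Theorems.SurfaceTension

variable {d : ℕ}

open Classical in
/-- **VISITS TO TWO FAR SHAPES ARE POSITIVELY CORRELATED BY THE MST GAIN** (`p_c(ℤ^d)`, `d ≥ 2`; (A2)□; `CU⁺_l(c_U)`): there are `0 < c, C`
such that for every IIC probability measure `ν`, `m ≥ 1`, shapes `S₁, S₂ ⊆ Λ(m)`, sites with `l(l(m+1)+2) ≤ ‖x₁‖`, `l(l(m+1)+2) ≤ ‖x₂‖`,
writing `hit_i = {∃ q ∈ x_i + S_i, 0 ↔ q}`, `r = ‖x₂ − x₁‖`: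
(lower, for `l(r+m+1) ≤ ‖x₂‖`) **`c·π((l+1)(r+m+1))·ν(hit₁)·ν(hit₂) ≤ π(‖x₂‖)·ν(hit₁ ∩ hit₂)`**;
(upper, for a scale `n₂` with `l(l(m+1)+2) ≤ n₂ ≤ ‖x₂‖`, `n₂ + m ≤ r`) **`π(‖x₂‖)·ν(hit₁ ∩ hit₂) ≤ C·π(n₂)·ν(hit₁)·ν(hit₂)`**.
[cite: Kesten1986, Thm. (8)] [cite: BasuSapozhnikov2017ECP, Thm. 1.1] -/
theorem exists_iicMeasure_real_twoShapes_correlation_criticalProbI (hd : 2 ≤ d) {s L : ℕ} (hs : 2 ≤ s) (hsL : s ≤ L)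
    {ϰ : ℝ} (hϰ : 0 < ϰ) (hA2 : SetToSetQuasiMultAspectAt d (criticalProbI d) s L ϰ) {l : ℕ} (hl : 2 ≤ l) {cU : ℝ} (hcU : 0 < cU)
    (hCU : ∀ a : ℕ, 1 ≤ a → ∀ E : Set (BondConfig (Site d)), IsUpperSet E → MeasurableSet E →
      cU * (bondPercolation (zdGraph d) (criticalProbI d)).real E ≤ (bondPercolation (zdGraph d) (criticalProbI d)).real (E ∩
        {ω : BondConfig (Site d) | ∀ t ∈ innerBoundary (zdGraph d) (box d a), ∀ s ∈ innerBoundary (zdGraph d) (box d (l * a)),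
        ∀ t' ∈ innerBoundary (zdGraph d) (box d a), ∀ s' ∈ innerBoundary (zdGraph d) (box d (l * a)),
        ω ∈ openConnIn (↑((box d (l * a) \ box d a) ∪ innerBoundary (zdGraph d) (box d a)) : Set (Site d)) t s →
        ω ∈ openConnIn (↑((box d (l * a) \ box d a) ∪ innerBoundary (zdGraph d) (box d a)) : Set (Site d)) t' s' →
        ω ∈ openConnIn (↑((box d (l * a) \ box d a) ∪ innerBoundary (zdGraph d) (box d a)) : Set (Site d)) s s'})) :
    ∃ c C : ℝ, 0 < c ∧ 0 < C ∧ ∀ (ν : Measure (BondConfig (Site d))) [IsProbabilityMeasure ν],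
      (∀ (F : Finset (Sym2 (Site d))) (E : Set (BondConfig (Site d))), MeasurableSet E → DeterminedBy E ↑F →
        Tendsto (fun n : ℕ => (bondPercolation (zdGraph d) (criticalProbI d)).real (E ∩ siteToBoundary d n) /
          oneArmProb d (criticalProbI d) n) atTop (𝓝 (ν.real E))) →
      ∀ (m : ℕ) (S₁ S₂ : Finset (Site d)) (x₁ x₂ : Site d), 1 ≤ m → S₁ ⊆ box d m → S₂ ⊆ box d m →
        l * (l * (m + 1) + 2) ≤ Site.supNorm x₁ → l * (l * (m + 1) + 2) ≤ Site.supNorm x₂ →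
        (l * (Site.supNorm (x₂ - x₁) + m + 1) ≤ Site.supNorm x₂ →
          c * oneArmProb d (criticalProbI d) ((l + 1) * (Site.supNorm (x₂ - x₁) + m + 1)) *
              ν.real {ω | ∃ q ∈ S₁.image (· + x₁), ω ∈ (openConn (0 : Site d) q : Set (BondConfig (Site d)))} *
              ν.real {ω | ∃ q ∈ S₂.image (· + x₂), ω ∈ (openConn (0 : Site d) q : Set (BondConfig (Site d)))} ≤
            oneArmProb d (criticalProbI d) (Site.supNorm x₂) *
              ν.real ({ω | ∃ q ∈ S₁.image (· + x₁), ω ∈ (openConn (0 : Site d) q : Set (BondConfig (Site d)))} ∩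
                {ω | ∃ q ∈ S₂.image (· + x₂), ω ∈ (openConn (0 : Site d) q : Set (BondConfig (Site d)))})) ∧
        (∀ n₂ : ℕ, l * (l * (m + 1) + 2) ≤ n₂ → n₂ ≤ Site.supNorm x₂ → n₂ + m ≤ Site.supNorm (x₂ - x₁) →
          oneArmProb d (criticalProbI d) (Site.supNorm x₂) *
              ν.real ({ω | ∃ q ∈ S₁.image (· + x₁), ω ∈ (openConn (0 : Site d) q : Set (BondConfig (Site d)))} ∩
                {ω | ∃ q ∈ S₂.image (· + x₂), ω ∈ (openConn (0 : Site d) q : Set (BondConfig (Site d)))}) ≤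
            C * oneArmProb d (criticalProbI d) n₂ *
              ν.real {ω | ∃ q ∈ S₁.image (· + x₁), ω ∈ (openConn (0 : Site d) q : Set (BondConfig (Site d)))} *
              ν.real {ω | ∃ q ∈ S₂.image (· + x₂), ω ∈ (openConn (0 : Site d) q : Set (BondConfig (Site d)))}) := by
  classical
  have hd1 : 1 ≤ d := le_trans (by norm_num) hd
  have hp : 0 < ((criticalProbI d : unitInterval) : ℝ) := by
    rw [coe_criticalProbI]; exact criticalProb_zd_pos d hd1
  have hπ : ∀ m : ℕ, 0 < oneArmProb d (criticalProbI d) m := fun m => oneArmProb_pos hd1 _ hp m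
  obtain ⟨c₀, C₀, hc₀, hC₀, htwo⟩ := exists_iicMeasure_real_exists_openConn_set_two_sided_criticalProbI hd hs hsL hϰ hA2 hl hcU hCU
  obtain ⟨c₁, hc₁, hlow⟩ := exists_iicMeasure_real_twoShapes_ge_criticalProbI hd hs hsL hϰ hA2 hl hcU hCU
  obtain ⟨C₁, hC₁, hup⟩ := exists_iicMeasure_real_twoShapes_le_criticalProbI hd hs hsL hϰ hA2 hl hcU hCU
  refine ⟨c₁ / (C₀ * C₀), C₁ / (c₀ * c₀), by positivity, by positivity, fun ν _ hν m S₁ S₂ x₁ x₂ hm hS₁ hS₂ hx₁ hx₂ => ?_⟩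
  set ρ := l * (m + 1) with hρ
  set μ := bondPercolation (zdGraph d) (criticalProbI d) with hμ
  set H₁ := ν.real {ω | ∃ q ∈ S₁.image (· + x₁), ω ∈ (openConn (0 : Site d) q : Set (BondConfig (Site d)))} with hH₁
  set H₂ := ν.real {ω | ∃ q ∈ S₂.image (· + x₂), ω ∈ (openConn (0 : Site d) q : Set (BondConfig (Site d)))} with hH₂
  set H₁₂ := ν.real ({ω | ∃ q ∈ S₁.image (· + x₁), ω ∈ (openConn (0 : Site d) q : Set (BondConfig (Site d)))} ∩
    {ω | ∃ q ∈ S₂.image (· + x₂), ω ∈ (openConn (0 : Site d) q : Set (BondConfig (Site d)))}) with hH₁₂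
  set P₁ := μ.real {ω : BondConfig (Site d) | ∃ q ∈ S₁, ∃ t ∈ innerBoundary (zdGraph d) (box d ρ),
    ω ∈ openConnIn (↑(box d ρ) : Set (Site d)) q t} with hP₁
  set P₂ := μ.real {ω : BondConfig (Site d) | ∃ q ∈ S₂, ∃ t ∈ innerBoundary (zdGraph d) (box d ρ),
    ω ∈ openConnIn (↑(box d ρ) : Set (Site d)) q t} with hP₂
  set n₁ := Site.supNorm x₁ with hn₁
  set N₂ := Site.supNorm x₂ with hN₂
  obtain ⟨h1lo, h1up⟩ := htwo ν hν m S₁ x₁ hm hS₁ hx₁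
  obtain ⟨h2lo, h2up⟩ := htwo ν hν m S₂ x₂ hm hS₂ hx₂
  rw [← hρ, ← hP₁, ← hH₁, ← hn₁] at h1lo h1up
  rw [← hρ, ← hP₂, ← hH₂, ← hN₂] at h2lo h2up
  have hH₁0 : 0 ≤ H₁ := measureReal_nonneg
  have hH₂0 : 0 ≤ H₂ := measureReal_nonneg
  have hH₁₂0 : 0 ≤ H₁₂ := measureReal_nonneg
  have hP₁0 : 0 ≤ P₁ := measureReal_nonneg
  have hP₂0 : 0 ≤ P₂ := measureReal_nonneg
  have hρ0 : oneArmProb d (criticalProbI d) ρ ≠ 0 := (hπ ρ).ne'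
  refine ⟨fun hx₂far => ?_, fun n₂ hn₂ hn₂x hr => ?_⟩
  · -- LOWER: `c₁ π(n₁) P₁ π(X) P₂ ≤ π(ρ)² H₁₂` and `H_i ≤ C₀ π(‖x_i‖) P_i/π(ρ)`
    have hl' := hlow ν hν m S₁ S₂ x₁ x₂ hm hS₁ hS₂ hx₁ hx₂far
    rw [← hρ, ← hP₁, ← hP₂, ← hn₁] at hl'
    set X := oneArmProb d (criticalProbI d) ((l + 1) * (Site.supNorm (x₂ - x₁) + m + 1)) with hX
    have hX0 : 0 ≤ X := (hπ _).le
    -- `H₁ H₂ ≤ C₀² π(n₁) π(N₂) P₁ P₂ / π(ρ)²`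
    have hprod : H₁ * H₂ ≤ (C₀ * oneArmProb d (criticalProbI d) n₁ * (P₁ / oneArmProb d (criticalProbI d) ρ)) *
        (C₀ * oneArmProb d (criticalProbI d) N₂ * (P₂ / oneArmProb d (criticalProbI d) ρ)) :=
      mul_le_mul h1up h2up hH₂0 (by
        exact mul_nonneg (mul_nonneg hC₀.le (hπ _).le) (div_nonneg hP₁0 (hπ ρ).le))
    have hkey : c₁ / (C₀ * C₀) * X * (H₁ * H₂) * oneArmProb d (criticalProbI d) ρ ^ 2 ≤
        oneArmProb d (criticalProbI d) N₂ * (oneArmProb d (criticalProbI d) ρ ^ 2 * H₁₂) := by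
      calc c₁ / (C₀ * C₀) * X * (H₁ * H₂) * oneArmProb d (criticalProbI d) ρ ^ 2
          ≤ c₁ / (C₀ * C₀) * X * ((C₀ * oneArmProb d (criticalProbI d) n₁ * (P₁ / oneArmProb d (criticalProbI d) ρ)) *
              (C₀ * oneArmProb d (criticalProbI d) N₂ * (P₂ / oneArmProb d (criticalProbI d) ρ))) * oneArmProb d (criticalProbI d) ρ ^ 2 :=
            mul_le_mul_of_nonneg_right (mul_le_mul_of_nonneg_left hprod
              (mul_nonneg (div_nonneg hc₁.le (mul_nonneg hC₀.le hC₀.le)) hX0)) (sq_nonneg _)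
        _ = oneArmProb d (criticalProbI d) N₂ * (c₁ * oneArmProb d (criticalProbI d) n₁ * P₁ * X * P₂) := by
            field_simp
        _ ≤ oneArmProb d (criticalProbI d) N₂ * (oneArmProb d (criticalProbI d) ρ ^ 2 * H₁₂) :=
            mul_le_mul_of_nonneg_left hl' (hπ _).le
    -- divide by `π(ρ)²`
    have hρ2 : 0 < oneArmProb d (criticalProbI d) ρ ^ 2 := pow_pos (hπ ρ) 2
    have hkey' : c₁ / (C₀ * C₀) * X * (H₁ * H₂) * oneArmProb d (criticalProbI d) ρ ^ 2 ≤
        oneArmProb d (criticalProbI d) N₂ * H₁₂ * oneArmProb d (criticalProbI d) ρ ^ 2 :=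
      hkey.trans (le_of_eq (by ring))
    have h := le_of_mul_le_mul_right hkey' hρ2
    calc c₁ / (C₀ * C₀) * X * H₁ * H₂ = c₁ / (C₀ * C₀) * X * (H₁ * H₂) := by ring
      _ ≤ oneArmProb d (criticalProbI d) N₂ * H₁₂ := h
  · -- UPPER: `π(ρ)² H₁₂ ≤ C₁ π(n₁) P₁ π(n₂) P₂` and `c₀ π(‖x_i‖) P_i/π(ρ) ≤ H_i`
    have hu' := hup ν hν m n₂ S₁ S₂ x₁ x₂ hm hS₁ hS₂ hx₁ hn₂ hn₂x hr
    rw [← hρ, ← hP₁, ← hP₂, ← hn₁] at hu'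
    have hprod : (c₀ * oneArmProb d (criticalProbI d) n₁ * (P₁ / oneArmProb d (criticalProbI d) ρ)) *
        (c₀ * oneArmProb d (criticalProbI d) N₂ * (P₂ / oneArmProb d (criticalProbI d) ρ)) ≤ H₁ * H₂ :=
      mul_le_mul h1lo h2lo (mul_nonneg (mul_nonneg hc₀.le (hπ _).le) (div_nonneg hP₂0 (hπ ρ).le)) hH₁0
    have hkey : oneArmProb d (criticalProbI d) N₂ * H₁₂ * oneArmProb d (criticalProbI d) ρ ^ 2 ≤
        C₁ / (c₀ * c₀) * oneArmProb d (criticalProbI d) n₂ * (H₁ * H₂) * oneArmProb d (criticalProbI d) ρ ^ 2 := by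
      calc oneArmProb d (criticalProbI d) N₂ * H₁₂ * oneArmProb d (criticalProbI d) ρ ^ 2
          = oneArmProb d (criticalProbI d) N₂ * (oneArmProb d (criticalProbI d) ρ ^ 2 * H₁₂) := by ring
        _ ≤ oneArmProb d (criticalProbI d) N₂ * (C₁ * oneArmProb d (criticalProbI d) n₁ * P₁ * oneArmProb d (criticalProbI d) n₂ * P₂) :=
            mul_le_mul_of_nonneg_left hu' (hπ _).le
        _ = C₁ / (c₀ * c₀) * oneArmProb d (criticalProbI d) n₂ *
              ((c₀ * oneArmProb d (criticalProbI d) n₁ * (P₁ / oneArmProb d (criticalProbI d) ρ)) *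
                (c₀ * oneArmProb d (criticalProbI d) N₂ * (P₂ / oneArmProb d (criticalProbI d) ρ))) * oneArmProb d (criticalProbI d) ρ ^ 2 := by
            field_simp
        _ ≤ C₁ / (c₀ * c₀) * oneArmProb d (criticalProbI d) n₂ * (H₁ * H₂) * oneArmProb d (criticalProbI d) ρ ^ 2 :=
            mul_le_mul_of_nonneg_right (mul_le_mul_of_nonneg_left hprod
              (mul_nonneg (div_nonneg hC₁.le (mul_nonneg hc₀.le hc₀.le)) (hπ n₂).le)) (sq_nonneg _)
    have hρ2 : 0 < oneArmProb d (criticalProbI d) ρ ^ 2 := pow_pos (hπ ρ) 2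
    have h := le_of_mul_le_mul_right hkey hρ2
    calc oneArmProb d (criticalProbI d) N₂ * H₁₂ ≤ C₁ / (c₀ * c₀) * oneArmProb d (criticalProbI d) n₂ * (H₁ * H₂) := h
      _ = C₁ / (c₀ * c₀) * oneArmProb d (criticalProbI d) n₂ * H₁ * H₂ := by ring

end Summit.CriticalPhenomena.PercolationContinuityZ3.Theorems.Crossing

end
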